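import Summits.QuantumFields.BalabanUV.Beta.GAN24.CapacitanceScalarDictionary

/-!
# `BalabanUV.Beta.GAN24.CapacitanceEndpointBlocks` — binder row G-an2-4 / (CONV-C), road P1-fibre, leaf P1-L08 of `SKELETON-P1.md` (the crux A4 `cap_lower`), part 1/2:
# N-UNIFORM BOUNDS OF THE FOUR EXPLICIT INVERSE BLOCKS at the real scalar data, constants displayed (part 2/2 = `GAN24/CapacitanceEndpoint`: the matrix `(cap N p)⁻¹`)

NOT IN PRINT; OUR PROOF ATTEMPT.  HONEST FRAMING (cell contract, verbatim): «discharging `BetaPertH` makes Bałaban's UV stability UNCONDITIONAL — a real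
constructive-QFT result; it is NOT the continuum limit and NOT the Clay problem.»  HONEST DEPENDENCY (verbatim): «continuum YM on T⁴ ⇐ BetaPertH ∧ nine spine
estimates (0/9 proved); BetaPertH ⇐ (D1) ∧ (D4) ∧ CAP+tail; G-an2-4 gates asym, D1 and NE2/3/4.»  [folklore] assembly of the cell's landed finite-dimensional
algebra (`GAN24/CapacitanceClosedForm`, leaf-02) with its landed explicit real analysis (`GAN24/CapacitanceScalarBounds(+Border,+Dictionary)`, leaf-12) — every
input BY NAME; no cited fact, no wall binder, no `def … : Prop` hypothesis, no cancellation used.  NOT summit progress: it discharges NOTHING of (CONV-C)'s K-slot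
`GAN24.CombesThomas.ConvCK 3 Lc` by itself (rows L09/L10/L11/L12 are downstream); 0 wall binders instantiated; NOT `BetaPertH`, NOT continuum, NOT Clay.

## What is proved (every `D`, every `N ≥ 1`, every `q ∈ [−π, π]^D` with `q ≠ 0`, `p = ofRealVec q`; `|q|² = momSq q`; constants symbolic in `D`)
* §1 `hSum (↑capDiag N q) (dhat p) (dflat p) = ↑(capH N q)` (the Schur scalar of leaf-02's closed form IS leaf-12's `capH`, in the `↑capDiag` currency).
* §2 THE CONSTANTS, displayed: `gFac D P = π²/8 + aliasWtConst D·P/2`, `cPP D = 2(π²/4)^{D+1} + 4(π²/4)^{2D+3}·gFac D (Dπ²)`,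
  `cPc D = 2(π²/4)^{2D+2}·gFac D (Dπ²)`, `ccc D = (π²/4)^D/2 + (π²/4)^{2D+1}·gFac D (Dπ²)` (`aliasWtConst D = (5^D − 1)/4` is leaf P1-L06's uniform
  alias-sum constant; `|q|² ≤ Dπ²` absorbs the higher `p`-orders); leaf-12's inverse bounds `inv_capDiag_le`/`inv_capBorder_le`/`inv_capH_le` in `π²/4`-form
  (`α = 2(π²/4)^{D+1}|q|²/N^{D+4}`, `ς = (π²/4)^D|q|⁴/N^{D+4}`, `η = (π²/4)N^{D+4}·gFac D |q|²/|q|⁴`) and in complex currency (the hypotheses of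
  `CapacitanceClosedForm` §6, with `ε = √|q|²` from leaf-12's `norm_dhat_ofRealVec_le_sqrt`/`norm_dflat_ofRealVec_le_sqrt`).
* §3 THE FOUR BLOCKS of the explicit inverse of `CapacitanceClosedForm` §5 at the REAL SCALAR DATA `a = ↑capDiag N q`, `σ = ↑capBorder N q`, `δ = dhat p`,
  `δ' = dflat p`, N-UNIFORMLY on the punctured zone (pure real algebra `alg_PP`/`alg_Pc`/`alg_cc` of `α + α²ε²η`, `αεςη`, `ς/2 + ς²η`):
  **`‖invPP κ l‖ ≤ cPP D·|q|²/N^{D+4}`**,  **`‖invPc κ‖, ‖invcP l‖ ≤ cPc D·|q|²√|q|²/N^{D+4}`** (`= O(|q|³/N^{D+4})`),  **`‖invcc‖ ≤ ccc D·|q|⁴/N^{D+4}`**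
  — `SKELETON-P1.md` A4′(iii) `(Cap⁻¹)_φφ = O(|p|²/N^{D+4})`, `(Cap⁻¹)_φc = O(|p|³/N^{D+4})`, and the NO-CANCELLATION corner order `|p|⁴/N^{D+4}` (the finer
  `|p|⁶`/`|p|⁸` cc-order is typer row P1-Y08cc — `GAN24/CapacitanceClosedFormGauge` + its analytic half — neither used nor touched here); the `…_le_poly`
  forms keep `gFac D |q|²` instead of its value at `|q|² = Dπ²`; and for arbitrary right-hand sides `(Q, R)` the closed-form solution obeys
  `‖phiCF … Q R κ‖ ≤ cPP·|q|²/N^{D+4}·Σ_l‖Q_l‖ + cPc·|q|²√|q|²/N^{D+4}·‖R‖`, `‖cCF … Q R‖ ≤ cPc·|q|²√|q|²/N^{D+4}·Σ_l‖Q_l‖ + ccc·|q|⁴/N^{D+4}·‖R‖`.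

Unit `b2b-balaban-gan24-formalise-leaf-20` (G-an2-4 formalisation swarm, leaf prover 20), 2026-08-19.  Value = kernel assembly leaf toward the K-slot route P1,
NOT summit progress.
-/

noncomputable section

open Complex Finset
open scoped BigOperators Real

namespace Summit.QuantumFields.BalabanUV.Beta.GAN24.CapacitanceEndpointBlocks

open Literature.MathematicalPhysics.QuantumFieldTheory.Balaban1983to89.B4Strip (ofRealVec)
open Literature.MathematicalPhysics.QuantumFieldTheory.King1986 (momSq momSq_nonneg)
open FibreSymbols (dhat dflat)
open FibreBlockSolve (dot)
open CapacitanceSolve (Fibre)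
open CapacitanceClosedForm (hSum invPP invPc invcP invcc phiCF cCF aDiag sigma)
open AliasWeightsSum (aliasWtConst)
open CapacitanceScalarBounds (capDiag capDiag_pos inv_capDiag_le momSq_pos)
open CapacitanceScalarBoundsBorder (capBorder capH capBorder_pos inv_capBorder_le capH_pos inv_capH_le)
open CapacitanceScalarDictionary (norm_inv_ofReal_of_pos norm_dhat_ofRealVec_le_sqrt norm_dflat_ofRealVec_le_sqrt)

variable {D : ℕ}

/-! ## §1 Dictionary: the Schur scalar of the closed form at the real scalar data -/

/-- [folklore] **`hSum (↑capDiag) (dhat p) (dflat p) = ↑(capH N q)`** at `p = ofRealVec q` (`dhat_κ·dflat_κ = 4 sin²(q_κ/2)`,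
`SymbolTaylor.dhat_mul_dflat_self_ofRealVec`; companion of leaf-12's `CapacitanceScalarDictionary.hSum_fibreAl`, in the `↑capDiag` currency). -/
theorem hSum_capDiag_eq (N : ℕ) [NeZero N] (q : Fin D → ℝ) :
    hSum (fun κ => (capDiag N q κ : ℂ)) (dhat (ofRealVec q)) (dflat (ofRealVec q)) = (capH N q : ℂ) := by
  unfold hSum CapacitanceScalarBoundsBorder.capH
  rw [Complex.ofReal_sum]
  refine Finset.sum_congr rfl fun κ _ => ?_
  rw [SymbolTaylor.dhat_mul_dflat_self_ofRealVec, Complex.ofReal_div]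

/-! ## §2 The constants and the three scalar hypotheses of `CapacitanceClosedForm` §6 in `π²/4`-form -/

/-- The `p`-dependent factor `gFac D P = π²/8 + aliasWtConst D · P/2` (`P = |q|²`; zero alias + the uniform alias-sum constant of leaf P1-L06). -/
def gFac (D : ℕ) (P : ℝ) : ℝ := π ^ 2 / 8 + aliasWtConst D * P / 2

/-- The `φφ`-block constant `cPP D = 2(π²/4)^{D+1} + 4(π²/4)^{2D+3}·gFac D (Dπ²)`. -/
def cPP (D : ℕ) : ℝ := 2 * (π ^ 2 / 4) ^ (D + 1) + 4 * (π ^ 2 / 4) ^ (2 * D + 3) * gFac D (D * π ^ 2)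

/-- The `φc`/`cφ`-block constant `cPc D = 2(π²/4)^{2D+2}·gFac D (Dπ²)`. -/
def cPc (D : ℕ) : ℝ := 2 * (π ^ 2 / 4) ^ (2 * D + 2) * gFac D (D * π ^ 2)

/-- The `cc`-block constant (no cancellation) `ccc D = (π²/4)^D/2 + (π²/4)^{2D+1}·gFac D (Dπ²)`. -/
def ccc (D : ℕ) : ℝ := (π ^ 2 / 4) ^ D / 2 + (π ^ 2 / 4) ^ (2 * D + 1) * gFac D (D * π ^ 2)

/-- [folklore] `0 ≤ aliasWtConst D = (5^D − 1)/4`. -/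
theorem aliasWtConst_nonneg (D : ℕ) : 0 ≤ aliasWtConst D := by
  unfold AliasWeightsSum.aliasWtConst
  have : (1 : ℝ) ≤ (5 : ℝ) ^ D := one_le_pow₀ (by norm_num)
  exact div_nonneg (by linarith) (by norm_num)

/-- [folklore] `0 < gFac D P` for `P ≥ 0`. -/
theorem gFac_pos (D : ℕ) {P : ℝ} (hP : 0 ≤ P) : 0 < gFac D P := by
  unfold gFac
  have := aliasWtConst_nonneg D
  positivity

/-- [folklore] `gFac` is monotone in `P`. -/
theorem gFac_mono (D : ℕ) {P P' : ℝ} (h : P ≤ P') : gFac D P ≤ gFac D P' := by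
  unfold gFac
  have := mul_le_mul_of_nonneg_left h (aliasWtConst_nonneg D)
  linarith

/-- [folklore] On the Brillouin zone `gFac D |q|² ≤ gFac D (Dπ²)` (`|q|² ≤ Dπ²`). -/
theorem gFac_momSq_le {q : Fin D → ℝ} (hq : ∀ i, |q i| ≤ π) : gFac D (momSq q) ≤ gFac D (D * π ^ 2) := by
  refine gFac_mono D ?_
  unfold momSq
  calc ∑ i, q i ^ 2 ≤ ∑ _i : Fin D, π ^ 2 :=
        Finset.sum_le_sum fun i _ => by rw [← sq_abs]; exact pow_le_pow_left₀ (abs_nonneg _) (hq i) 2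
    _ = D * π ^ 2 := by simp

/-- [folklore] `0 < cPP D`. -/
theorem cPP_pos (D : ℕ) : 0 < cPP D := by
  unfold cPP; have := gFac_pos D (by positivity : (0 : ℝ) ≤ D * π ^ 2); positivity

/-- [folklore] `0 < cPc D`. -/
theorem cPc_pos (D : ℕ) : 0 < cPc D := by
  unfold cPc; have := gFac_pos D (by positivity : (0 : ℝ) ≤ D * π ^ 2); positivity

/-- [folklore] `0 < ccc D`. -/
theorem ccc_pos (D : ℕ) : 0 < ccc D := by
  unfold ccc; have := gFac_pos D (by positivity : (0 : ℝ) ≤ D * π ^ 2); positivity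

/-- [folklore] `(4/π²)^n = ((π²/4)^n)⁻¹`. -/
theorem four_div_pi_sq_pow (n : ℕ) : (4 / π ^ 2 : ℝ) ^ n = ((π ^ 2 / 4) ^ n)⁻¹ := by
  rw [← inv_pow, inv_div]

section scalars
variable {N : ℕ} [NeZero N] {q : Fin D → ℝ}

/-- [folklore] `α`-HYPOTHESIS (leaf-12's `inv_capDiag_le` in `π²/4`-form): `a_κ⁻¹ ≤ 2(π²/4)^{D+1}·|q|²/N^{D+4}`. -/
theorem inv_capDiag_le' (hN : 1 ≤ N) (hq : ∀ i, |q i| ≤ π) (hq0 : q ≠ 0) (κ : Fin D) :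
    (capDiag N q κ)⁻¹ ≤ 2 * (π ^ 2 / 4) ^ (D + 1) * momSq q / (N : ℝ) ^ (D + 4) := by
  have hN0 : (0 : ℝ) < N := by exact_mod_cast hN
  have hr : (0 : ℝ) < (π ^ 2 / 4) ^ (D + 1) := by positivity
  refine (inv_capDiag_le hN hq hq0 κ).trans (le_of_eq ?_)
  rw [four_div_pi_sq_pow]
  field_simp

/-- [folklore] `ς`-HYPOTHESIS (leaf-12's `inv_capBorder_le` in `π²/4`-form): `σ⁻¹ ≤ (π²/4)^D·|q|⁴/N^{D+4}`. -/
theorem inv_capBorder_le' (hN : 1 ≤ N) (hq : ∀ i, |q i| ≤ π) (hq0 : q ≠ 0) :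
    (capBorder N q)⁻¹ ≤ (π ^ 2 / 4) ^ D * momSq q ^ 2 / (N : ℝ) ^ (D + 4) := by
  have hN0 : (0 : ℝ) < N := by exact_mod_cast hN
  have hr : (0 : ℝ) < (π ^ 2 / 4) ^ D := by positivity
  refine (inv_capBorder_le hN hq hq0).trans (le_of_eq ?_)
  rw [four_div_pi_sq_pow]
  field_simp

/-- [folklore] `η`-HYPOTHESIS (leaf-12's `inv_capH_le` in `π²/4`-form): `h⁻¹ ≤ (π²/4)·N^{D+4}·gFac D |q|²/|q|⁴`. -/
theorem inv_capH_le' (hN : 1 ≤ N) (hq : ∀ i, |q i| ≤ π) (hq0 : q ≠ 0) :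
    (capH N q)⁻¹ ≤ π ^ 2 / 4 * (N : ℝ) ^ (D + 4) * gFac D (momSq q) / momSq q ^ 2 := by
  have hN0 : (0 : ℝ) < N := by exact_mod_cast hN
  have hP := momSq_pos hq0
  have hπ : (0 : ℝ) < π := Real.pi_pos
  refine (inv_capH_le hN hq hq0).trans (le_of_eq ?_)
  unfold gFac
  field_simp

/-- [folklore] `α` in complex currency: `‖(↑a_κ)⁻¹‖ ≤ 2(π²/4)^{D+1}·|q|²/N^{D+4}`. -/
theorem norm_inv_capDiagC_le (hN : 1 ≤ N) (hq : ∀ i, |q i| ≤ π) (hq0 : q ≠ 0) (κ : Fin D) :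
    ‖((capDiag N q κ : ℂ))⁻¹‖ ≤ 2 * (π ^ 2 / 4) ^ (D + 1) * momSq q / (N : ℝ) ^ (D + 4) := by
  rw [norm_inv_ofReal_of_pos (capDiag_pos hN hq hq0 κ)]
  exact inv_capDiag_le' hN hq hq0 κ

/-- [folklore] `ς` in complex currency: `‖(↑σ)⁻¹‖ ≤ (π²/4)^D·|q|⁴/N^{D+4}`. -/
theorem norm_inv_capBorderC_le (hN : 1 ≤ N) (hq : ∀ i, |q i| ≤ π) (hq0 : q ≠ 0) :
    ‖((capBorder N q : ℂ))⁻¹‖ ≤ (π ^ 2 / 4) ^ D * momSq q ^ 2 / (N : ℝ) ^ (D + 4) := by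
  rw [norm_inv_ofReal_of_pos (capBorder_pos hN hq hq0)]
  exact inv_capBorder_le' hN hq hq0

/-- [folklore] `η` in complex currency: `‖(hSum ↑a (dhat p) (dflat p))⁻¹‖ ≤ (π²/4)·N^{D+4}·gFac D |q|²/|q|⁴`. -/
theorem norm_inv_hSumC_le (hN : 1 ≤ N) (hq : ∀ i, |q i| ≤ π) (hq0 : q ≠ 0) :
    ‖(hSum (fun κ => (capDiag N q κ : ℂ)) (dhat (ofRealVec q)) (dflat (ofRealVec q)))⁻¹‖
      ≤ π ^ 2 / 4 * (N : ℝ) ^ (D + 4) * gFac D (momSq q) / momSq q ^ 2 := by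
  rw [hSum_capDiag_eq, norm_inv_ofReal_of_pos (capH_pos hN hq hq0)]
  exact inv_capH_le' hN hq hq0

end scalars

/-! ## §3 The four block bounds at the real scalar data -/

/-- [folklore] Real algebra of the `φφ` composition `α + α²ε²η`. -/
theorem alg_PP (n : ℕ) {P M : ℝ} (r G : ℝ) (hP : P ≠ 0) (hM : M ≠ 0) :
    2 * r ^ (n + 1) * P / M + (2 * r ^ (n + 1) * P / M) ^ 2 * P * (r * M * G / P ^ 2)
      = (2 * r ^ (n + 1) + 4 * r ^ (2 * n + 3) * G) * P / M := by
  field_simp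
  ring

/-- [folklore] Real algebra of the `φc` composition `αεςη`. -/
theorem alg_Pc (n : ℕ) {P M : ℝ} (r G s : ℝ) (hP : P ≠ 0) (hM : M ≠ 0) :
    2 * r ^ (n + 1) * P / M * s * (r ^ n * P ^ 2 / M) * (r * M * G / P ^ 2) = 2 * r ^ (2 * n + 2) * G * (P * s) / M := by
  field_simp
  ring

/-- [folklore] Real algebra of the `cc` composition `ς/2 + ς²η`. -/
theorem alg_cc (n : ℕ) {P M : ℝ} (r G : ℝ) (hP : P ≠ 0) (hM : M ≠ 0) :
    r ^ n * P ^ 2 / M / 2 + (r ^ n * P ^ 2 / M) ^ 2 * (r * M * G / P ^ 2) = (r ^ n / 2 + r ^ (2 * n + 1) * G) * P ^ 2 / M := by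
  field_simp
  ring

section blocks
variable {N : ℕ} [NeZero N] {q : Fin D → ℝ}

/-- **`φφ` BLOCK, `p`-polynomial form**: `‖invPP κ l‖ ≤ (2(π²/4)^{D+1} + 4(π²/4)^{2D+3}·gFac D |q|²)·|q|²/N^{D+4}`. [folklore] -/
theorem norm_invPP_le_poly (hN : 1 ≤ N) (hq : ∀ i, |q i| ≤ π) (hq0 : q ≠ 0) (κ l : Fin D) :
    ‖invPP (fun κ => (capDiag N q κ : ℂ)) (dhat (ofRealVec q)) (dflat (ofRealVec q)) κ l‖
      ≤ (2 * (π ^ 2 / 4) ^ (D + 1) + 4 * (π ^ 2 / 4) ^ (2 * D + 3) * gFac D (momSq q)) * momSq q / (N : ℝ) ^ (D + 4) := by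
  have hN0 : (0 : ℝ) < N := by exact_mod_cast hN
  have hP := momSq_pos hq0
  have hM : (0 : ℝ) < (N : ℝ) ^ (D + 4) := by positivity
  have h := CapacitanceClosedForm.norm_invPP_le (fun κ => (capDiag N q κ : ℂ)) (dhat (ofRealVec q)) (dflat (ofRealVec q))
    (norm_inv_capDiagC_le hN hq hq0) (norm_dhat_ofRealVec_le_sqrt q) (norm_dflat_ofRealVec_le_sqrt q) (norm_inv_hSumC_le hN hq hq0) κ l
  rw [Real.sq_sqrt hP.le, alg_PP D (π ^ 2 / 4) (gFac D (momSq q)) hP.ne' hM.ne'] at h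
  exact h

/-- **`φφ` BLOCK**: `‖invPP κ l‖ ≤ cPP D · |q|²/N^{D+4}`, uniformly in `N ≥ 1`, on `[−π, π]^D ∖ {0}`. [folklore] -/
theorem norm_invPP_le (hN : 1 ≤ N) (hq : ∀ i, |q i| ≤ π) (hq0 : q ≠ 0) (κ l : Fin D) :
    ‖invPP (fun κ => (capDiag N q κ : ℂ)) (dhat (ofRealVec q)) (dflat (ofRealVec q)) κ l‖ ≤ cPP D * momSq q / (N : ℝ) ^ (D + 4) := by
  have hN0 : (0 : ℝ) < N := by exact_mod_cast hN
  have hP := momSq_pos hq0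
  refine (norm_invPP_le_poly hN hq hq0 κ l).trans (div_le_div_of_nonneg_right (mul_le_mul_of_nonneg_right ?_ hP.le) (by positivity))
  unfold cPP
  have := mul_le_mul_of_nonneg_left (gFac_momSq_le hq) (by positivity : (0 : ℝ) ≤ 4 * (π ^ 2 / 4) ^ (2 * D + 3))
  linarith

/-- **`φc` BLOCK, `p`-polynomial form**: `‖invPc κ‖ ≤ 2(π²/4)^{2D+2}·gFac D |q|² · |q|²√|q|²/N^{D+4}`. [folklore] -/
theorem norm_invPc_le_poly (hN : 1 ≤ N) (hq : ∀ i, |q i| ≤ π) (hq0 : q ≠ 0) (κ : Fin D) :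
    ‖invPc (fun κ => (capDiag N q κ : ℂ)) (dhat (ofRealVec q)) (dflat (ofRealVec q)) (capBorder N q : ℂ) κ‖
      ≤ 2 * (π ^ 2 / 4) ^ (2 * D + 2) * gFac D (momSq q) * (momSq q * Real.sqrt (momSq q)) / (N : ℝ) ^ (D + 4) := by
  have hN0 : (0 : ℝ) < N := by exact_mod_cast hN
  have hP := momSq_pos hq0
  have hM : (0 : ℝ) < (N : ℝ) ^ (D + 4) := by positivity
  have h := CapacitanceClosedForm.norm_invPc_le (fun κ => (capDiag N q κ : ℂ)) (dhat (ofRealVec q)) (dflat (ofRealVec q))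
    (capBorder N q : ℂ) (norm_inv_capDiagC_le hN hq hq0) (norm_dhat_ofRealVec_le_sqrt q) (norm_inv_capBorderC_le hN hq hq0)
    (norm_inv_hSumC_le hN hq hq0) κ
  rw [alg_Pc D (π ^ 2 / 4) (gFac D (momSq q)) (Real.sqrt (momSq q)) hP.ne' hM.ne'] at h
  exact h

/-- **`φc` BLOCK**: `‖invPc κ‖ ≤ cPc D · |q|²√|q|²/N^{D+4}` (`= O(|q|³/N^{D+4})`), uniformly in `N ≥ 1`. [folklore] -/
theorem norm_invPc_le (hN : 1 ≤ N) (hq : ∀ i, |q i| ≤ π) (hq0 : q ≠ 0) (κ : Fin D) :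
    ‖invPc (fun κ => (capDiag N q κ : ℂ)) (dhat (ofRealVec q)) (dflat (ofRealVec q)) (capBorder N q : ℂ) κ‖
      ≤ cPc D * (momSq q * Real.sqrt (momSq q)) / (N : ℝ) ^ (D + 4) := by
  have hN0 : (0 : ℝ) < N := by exact_mod_cast hN
  have hP := momSq_pos hq0
  have hPs : 0 ≤ momSq q * Real.sqrt (momSq q) := by positivity
  refine (norm_invPc_le_poly hN hq hq0 κ).trans (div_le_div_of_nonneg_right (mul_le_mul_of_nonneg_right ?_ hPs) (by positivity))
  unfold cPc
  exact mul_le_mul_of_nonneg_left (gFac_momSq_le hq) (by positivity)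

/-- **`cφ` BLOCK, `p`-polynomial form**: `‖invcP l‖ ≤ 2(π²/4)^{2D+2}·gFac D |q|² · |q|²√|q|²/N^{D+4}`. [folklore] -/
theorem norm_invcP_le_poly (hN : 1 ≤ N) (hq : ∀ i, |q i| ≤ π) (hq0 : q ≠ 0) (l : Fin D) :
    ‖invcP (fun κ => (capDiag N q κ : ℂ)) (dhat (ofRealVec q)) (dflat (ofRealVec q)) (capBorder N q : ℂ) l‖
      ≤ 2 * (π ^ 2 / 4) ^ (2 * D + 2) * gFac D (momSq q) * (momSq q * Real.sqrt (momSq q)) / (N : ℝ) ^ (D + 4) := by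
  have hN0 : (0 : ℝ) < N := by exact_mod_cast hN
  have hP := momSq_pos hq0
  have hM : (0 : ℝ) < (N : ℝ) ^ (D + 4) := by positivity
  have h := CapacitanceClosedForm.norm_invcP_le (fun κ => (capDiag N q κ : ℂ)) (dhat (ofRealVec q)) (dflat (ofRealVec q))
    (capBorder N q : ℂ) (norm_inv_capDiagC_le hN hq hq0) (norm_dflat_ofRealVec_le_sqrt q) (norm_inv_capBorderC_le hN hq hq0)
    (norm_inv_hSumC_le hN hq hq0) l
  rw [alg_Pc D (π ^ 2 / 4) (gFac D (momSq q)) (Real.sqrt (momSq q)) hP.ne' hM.ne'] at h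
  exact h

/-- **`cφ` BLOCK**: `‖invcP l‖ ≤ cPc D · |q|²√|q|²/N^{D+4}`, uniformly in `N ≥ 1`. [folklore] -/
theorem norm_invcP_le (hN : 1 ≤ N) (hq : ∀ i, |q i| ≤ π) (hq0 : q ≠ 0) (l : Fin D) :
    ‖invcP (fun κ => (capDiag N q κ : ℂ)) (dhat (ofRealVec q)) (dflat (ofRealVec q)) (capBorder N q : ℂ) l‖
      ≤ cPc D * (momSq q * Real.sqrt (momSq q)) / (N : ℝ) ^ (D + 4) := by
  have hN0 : (0 : ℝ) < N := by exact_mod_cast hN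
  have hP := momSq_pos hq0
  have hPs : 0 ≤ momSq q * Real.sqrt (momSq q) := by positivity
  refine (norm_invcP_le_poly hN hq hq0 l).trans (div_le_div_of_nonneg_right (mul_le_mul_of_nonneg_right ?_ hPs) (by positivity))
  unfold cPc
  exact mul_le_mul_of_nonneg_left (gFac_momSq_le hq) (by positivity)

/-- **`cc` BLOCK, `p`-polynomial form** (no cancellation): `‖invcc‖ ≤ ((π²/4)^D/2 + (π²/4)^{2D+1}·gFac D |q|²)·|q|⁴/N^{D+4}`. [folklore] -/
theorem norm_invcc_le_poly (hN : 1 ≤ N) (hq : ∀ i, |q i| ≤ π) (hq0 : q ≠ 0) :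
    ‖invcc (fun κ => (capDiag N q κ : ℂ)) (dhat (ofRealVec q)) (dflat (ofRealVec q)) (capBorder N q : ℂ)‖
      ≤ ((π ^ 2 / 4) ^ D / 2 + (π ^ 2 / 4) ^ (2 * D + 1) * gFac D (momSq q)) * momSq q ^ 2 / (N : ℝ) ^ (D + 4) := by
  have hN0 : (0 : ℝ) < N := by exact_mod_cast hN
  have hP := momSq_pos hq0
  have hM : (0 : ℝ) < (N : ℝ) ^ (D + 4) := by positivity
  have h := CapacitanceClosedForm.norm_invcc_le (fun κ => (capDiag N q κ : ℂ)) (dhat (ofRealVec q)) (dflat (ofRealVec q))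
    (capBorder N q : ℂ) (norm_inv_capBorderC_le hN hq hq0) (norm_inv_hSumC_le hN hq hq0)
  rw [alg_cc D (π ^ 2 / 4) (gFac D (momSq q)) hP.ne' hM.ne'] at h
  exact h

/-- **`cc` BLOCK** (no cancellation): `‖invcc‖ ≤ ccc D · |q|⁴/N^{D+4}`, uniformly in `N ≥ 1`. [folklore] -/
theorem norm_invcc_le (hN : 1 ≤ N) (hq : ∀ i, |q i| ≤ π) (hq0 : q ≠ 0) :
    ‖invcc (fun κ => (capDiag N q κ : ℂ)) (dhat (ofRealVec q)) (dflat (ofRealVec q)) (capBorder N q : ℂ)‖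
      ≤ ccc D * momSq q ^ 2 / (N : ℝ) ^ (D + 4) := by
  have hN0 : (0 : ℝ) < N := by exact_mod_cast hN
  refine (norm_invcc_le_poly hN hq hq0).trans (div_le_div_of_nonneg_right (mul_le_mul_of_nonneg_right ?_ (sq_nonneg _)) (by positivity))
  unfold ccc
  have := mul_le_mul_of_nonneg_left (gFac_momSq_le hq) (by positivity : (0 : ℝ) ≤ (π ^ 2 / 4) ^ (2 * D + 1))
  linarith

/-- **CLOSED-FORM `φ` BOUND** [folklore]: for arbitrary right-hand sides `(Q, R)`,
`‖phiCF … Q R κ‖ ≤ cPP·|q|²/N^{D+4}·Σ_l ‖Q_l‖ + cPc·|q|²√|q|²/N^{D+4}·‖R‖` (`phiCF_eq_blocks` + the block bounds). -/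
theorem norm_phiCF_le (hN : 1 ≤ N) (hq : ∀ i, |q i| ≤ π) (hq0 : q ≠ 0) (Q : Fin D → ℂ) (R : ℂ) (κ : Fin D) :
    ‖phiCF (fun κ => (capDiag N q κ : ℂ)) (dhat (ofRealVec q)) (dflat (ofRealVec q)) (capBorder N q : ℂ) Q R κ‖
      ≤ cPP D * momSq q / (N : ℝ) ^ (D + 4) * ∑ l, ‖Q l‖ + cPc D * (momSq q * Real.sqrt (momSq q)) / (N : ℝ) ^ (D + 4) * ‖R‖ := by
  rw [CapacitanceClosedForm.phiCF_eq_blocks]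
  refine (norm_add_le _ _).trans (add_le_add ?_ ?_)
  · refine (norm_sum_le _ _).trans ?_
    rw [Finset.mul_sum]
    refine Finset.sum_le_sum fun l _ => ?_
    rw [norm_mul]
    exact mul_le_mul_of_nonneg_right (norm_invPP_le hN hq hq0 κ l) (norm_nonneg _)
  · rw [norm_mul]
    exact mul_le_mul_of_nonneg_right (norm_invPc_le hN hq hq0 κ) (norm_nonneg _)

/-- **CLOSED-FORM `c` BOUND** [folklore] (no cancellation):
`‖cCF … Q R‖ ≤ cPc·|q|²√|q|²/N^{D+4}·Σ_l ‖Q_l‖ + ccc·|q|⁴/N^{D+4}·‖R‖`. -/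
theorem norm_cCF_le (hN : 1 ≤ N) (hq : ∀ i, |q i| ≤ π) (hq0 : q ≠ 0) (Q : Fin D → ℂ) (R : ℂ) :
    ‖cCF (fun κ => (capDiag N q κ : ℂ)) (dhat (ofRealVec q)) (dflat (ofRealVec q)) (capBorder N q : ℂ) Q R‖
      ≤ cPc D * (momSq q * Real.sqrt (momSq q)) / (N : ℝ) ^ (D + 4) * ∑ l, ‖Q l‖ + ccc D * momSq q ^ 2 / (N : ℝ) ^ (D + 4) * ‖R‖ := by
  rw [CapacitanceClosedForm.cCF_eq_blocks]
  refine (norm_add_le _ _).trans (add_le_add ?_ ?_)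
  · refine (norm_sum_le _ _).trans ?_
    rw [Finset.mul_sum]
    refine Finset.sum_le_sum fun l _ => ?_
    rw [norm_mul]
    exact mul_le_mul_of_nonneg_right (norm_invcP_le hN hq hq0 l) (norm_nonneg _)
  · rw [norm_mul]
    exact mul_le_mul_of_nonneg_right (norm_invcc_le hN hq hq0) (norm_nonneg _)

end blocks

end Summit.QuantumFields.BalabanUV.Beta.GAN24.CapacitanceEndpointBlocks

end
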